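import Summits.CriticalPhenomena.PercolationContinuityZ3.Cruxes.PinholeClosing.SketchIdeator2
import Summits.CriticalPhenomena.PercolationContinuityZ3.Theorems.PinholeClosing.Negative.PinholeClosingResistance

/-!
# crux-plan `transit-doubling` for crux `PercBudgetLadder.PinholeClosing` (stmt-CriticalPhenomena-5249)
# — NO SKELETON at the fixed signature; certificate + salvage

Seat: planner-cruxplan-stmt-CriticalPhenomena-5249-transit-doubling-0 (2026-08-16).  Published in the crux directory as
`TransitDoublingSalvage.lean` (importable); the verdict card is `Lines/transit-doubling.md` (status: no-skeleton).

This file is NOT a skeleton: it contains no `stub_*` and no `PinholeClosing_of`.  It records, kernel-checked,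
WHY the transit lever cannot be composed into the fixed decl, and the corrected (lattice-guarded) form of the
lemma for reuse elsewhere (it is `FlatLandscapeExclusion 1` of card `budget-halving`, and the `k = 0` rung of any
restated crux whose conclusion radius is `≥ (2l+1)n`).

* `TransitLemmaL` — the card's `TransitLemma` with the hypothesis `ω ⊆ (zdGraph 3).edgeSet` that triage r1-1
  showed to be necessary (`TriageR1K1.not_transitLemma`, file `NotTransitLemmaAsTyped-triage1.lean`); a.s. under
  `P_{p_c}` (`Negative.ae_subset`).  `transitLemmaL_of_transitLemma`: it is weaker than the card's statement.
* `transit_band_empty` — the lever's own guards `l*n + n ≤ R` (start of the target crossing outside every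
  translate interior) and `R + l*n ≤ L` (end outside) are UNSATISFIABLE at the crux's conclusion radius
  `L = 2*l*n` for `n ≥ 1`: the band of admissible sphere radii is empty.  `transit_band_wide`: the least
  admissible radius is `(2l+1)n` (with `R = ln + n`).
* `zeroRung_literal_le_wide` — direction of the gap: blocking at the literal radius `2ln` is the SMALLER event
  (a.s., `Negative.blockProb_mono_aspect`), so the wide rung the lever proves (`PinholeClosingZeroWide`) is implied
  by, and does not imply, the `k = 0` instance of the crux.
* `pinholeClosing_zero_instance` — what a skeleton would have to deliver at `k = 0` (definitional unfolding of
  the route decl at `k = 0`), for comparison with `PinholeClosingZeroWide`.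
-/

namespace Summit.CriticalPhenomena.PercolationContinuityZ3.Cruxes.PinholeClosing.TransitDoubling

open Literature.Probability.Percolation Literature.Probability.LatticeModels
open Summit.CriticalPhenomena.PercolationContinuityZ3.Theorems.PinholeClosing

noncomputable section

set_option maxHeartbeats 800000

/-- **Transit doubling, corrected statement** (lattice configurations only).  For `1 ≤ n`, `1 ≤ l`,
`l n + n ≤ R`, `R + l n ≤ L`: if every translate `z + A(n, ln)` centred on the sphere `∂ⁱⁿ box R` has budget
`≤ 1`, then `box n → ∂ⁱⁿ box L` is not crossed.  Proof on the card (last-exit / first-exit around the first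
visit to the sphere; two edge-disjoint crossings of one translate; a `≤ 1`-edge set misses one), verified on
paper by all three triagers; size M (walk surgery: `Walk.takeUntil/dropUntil`, `IsPath.edges_nodup`). -/
def TransitLemmaL : Prop :=
  ∀ (n l R L : ℕ), 1 ≤ n → 1 ≤ l → l * n + n ≤ R → R + l * n ≤ L →
    ∀ ω : BondConfig (Site 3), ω ⊆ (zdGraph 3).edgeSet →
      (∀ z ∈ innerBoundary (zdGraph 3) (box 3 R), ω ∈ BudgetAt z n (l * n) 1) → ¬ Cross n L ω

/-- The corrected statement is weaker than the card's (false) `∀ ω` statement. -/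
theorem transitLemmaL_of_transitLemma (h : TransitLemma) : TransitLemmaL :=
  fun n l R L hn hl hR hL ω _ hB => h n l R L hn hl hR hL ω hB

/-- **No-go at the fixed signature (band emptiness).**  At the crux's conclusion radius `L = 2ln` the two
guards of the transit lever cannot hold simultaneously for any sphere radius `R` once `n ≥ 1`. -/
theorem transit_band_empty {n l R : ℕ} (hn : 1 ≤ n) (h1 : l * n + n ≤ R) (h2 : R + l * n ≤ 2 * l * n) :
    False := by
  have h3 : 2 * l * n = l * n + l * n := by ring
  omega

/-- Equivalent form: `TransitLemmaL` has NO instance with `L = 2 * l * n` and `n ≥ 1`. -/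
theorem transit_no_instance_at_literal_radius (n l R : ℕ) (hn : 1 ≤ n) :
    ¬ (l * n + n ≤ R ∧ R + l * n ≤ 2 * l * n) :=
  fun h => transit_band_empty hn h.1 h.2

/-- The least admissible conclusion radius is `(2l+1)n`, attained with `R = ln + n`. -/
theorem transit_band_wide (n l : ℕ) :
    l * n + n ≤ l * n + n ∧ (l * n + n) + l * n ≤ (2 * l + 1) * n := by
  refine ⟨le_rfl, ?_⟩
  have h : (2 * l + 1) * n = l * n + n + l * n := by ring
  omega

/-- Conversely every admissible `L` is at least `(2l+1)n`. -/
theorem transit_radius_ge {n l R L : ℕ} (h1 : l * n + n ≤ R) (h2 : R + l * n ≤ L) :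
    (2 * l + 1) * n ≤ L := by
  have h : (2 * l + 1) * n = l * n + n + l * n := by ring
  omega

/-- **Direction of the gap.**  Blocking (budget `0`, indeed any budget `k`) at the literal radius `2ln` is the
smaller event: `P(Budget n (2ln) k) ≤ P(Budget n ((2l+1)n) k)` (a.s. first-exit decomposition, landed as
`Negative.blockProb_mono_aspect`).  The transit lever lower-bounds the RIGHT-hand side only. -/
theorem zeroRung_literal_le_wide (k n l : ℕ) (hl : 1 ≤ l) :
    Pc.real (Budget n (2 * l * n) k) ≤ Pc.real (Budget n ((2 * l + 1) * n) k) := by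
  have h1 : n ≤ 2 * l * n := Nat.le_mul_of_pos_left n (by omega)
  have h2 : 2 * l * n ≤ (2 * l + 1) * n := by
    have : (2 * l + 1) * n = 2 * l * n + n := by ring
    omega
  exact Negative.blockProb_mono_aspect (k := k) h1 h2

/-- The `k = 0` instance of the FIXED crux decl, unfolded (what a skeleton's `k = 0` stub must deliver):
conclusion at radius `2 * l * n`, budget `0`.  Compare `PinholeClosingZeroWide` (radius `(2l+1)n`). -/
def PinholeClosingZeroLiteral : Prop :=
  ∀ (l : ℕ) (c : ℝ), 2 ≤ l → 0 < c → ∃ c' : ℝ, 0 < c' ∧ ∀ n : ℕ, 1 ≤ n →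
    c ≤ Pc.real (Budget n (l * n) 1) → c' ≤ Pc.real (Budget n (2 * l * n) 0)

/-- `PinholeClosing` at `k = 0` is literally `PinholeClosingZeroLiteral`. -/
theorem pinholeClosing_zero_instance (h : Theses.PercBudgetLadder.PinholeClosing) :
    PinholeClosingZeroLiteral :=
  fun l c hl hc => h 0 l c hl hc

/-- The literal `k = 0` rung implies the wide one (so the wide rung is the weaker statement; the converse —
what the transit lever would need — is an aspect-comparison of blocking probabilities at `p_c`, an RSW-type
statement with no known d = 3 proof). -/
theorem zeroWide_of_zeroLiteral (h : PinholeClosingZeroLiteral) : PinholeClosingZeroWide := by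
  intro l c hl hc
  obtain ⟨c', hc', hstep⟩ := h l c hl hc
  refine ⟨c', hc', fun n hn hb => ?_⟩
  have h1 : c' ≤ Pc.real (Budget n (2 * l * n) 0) := hstep n hn hb
  have h2 : Pc.real (Budget n (2 * l * n) 0) ≤ Pc.real (Budget n ((2 * l + 1) * n) 0) :=
    zeroRung_literal_le_wide 0 n l (by omega)
  have hset : Budget n ((2 * l + 1) * n) 0 = {ω | ¬ Cross n ((2 * l + 1) * n) ω} :=
    Set.ext fun ω => budget_zero_iff n ((2 * l + 1) * n) ω
  rw [hset] at h2
  exact h1.trans h2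

end

end Summit.CriticalPhenomena.PercolationContinuityZ3.Cruxes.PinholeClosing.TransitDoubling
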